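/-
Copyright (c) 2026 the pub-hodgecm-mathlib formalisation cell (harness21).  Prover seat hodgecm-mathlib-LH4-p07 (g8), req620 Track A «(D-RAM) FOUR-FRAME» squad
(STAGE-1b pre-scoping, heir LEAD F0P3a-plan (g20) T19-24 clause; dealer LH4-plan (g12) STATUS #18 board «p07 (g8): row-(2) type-(2) population»), 2026-09-04.
-/
import Summits.HodgeConjecture.HodgeConjecture.Theorems.F0P3cDyRamBlockCensusOrderForm   -- ★ (C1) p857559 (LH4-p11 (g5)): brings ★ W4 `…WSideOrderCensus`, ★ (C) `EllipticPlaneAsFieldLine(Dictionary)`, ★ DEFS `…ToricCensusDefs`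
import HarnessLib

/-!
# Crux `H413`, line LH4 «(D-RAM) FOUR-FRAME» — STAGE-1b, row (2): organ (C1-P) part 2a «THE AXIS TERM IN M-LETTERS WITH A LEVEL TOKEN»
# `#{B₂ ∣ SD_W, γ₂B₂ = B₂, (γ₂ − 1)B₂ ⊆ c·B₂} = Σ_{j ≤ J} [lam ∈ 𝒪_j ∧ (lam − 1)∕jE c ∈ 𝒪_j]·#levelSet(j, 0)`

Cell `hodgecm-mathlib` (D-0151), FLOOR 0, crux item H413 = `stmt-HodgeConjecture-24833`, route of record `HCCMUnconditional`; squad F0∕P3c∕LH4; lane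
`--supports stmt-HodgeConjecture-24833 --as helper` (count-neutral; pays NO tier-0 row).  THEOREMS ONLY (no `def`, no instance, no notation, no `sorry`).  DATUM-FREE
(abstract valued fields `E` ⊂ `M` as in ★ (C1): `ρ = Gal(M∕E)`, `Θ` the adjoint involution, `α` the integral generator, the line model `φ`).

WHAT THIS IS.  The axis term of ★ (C1-P) part 1 (★ `Theorems/F0P3cDyRamBlockGlueLevelCount`, this seat): `#{B₂ ∣ SD_W ∧ γ₂B₂ = B₂ ∧ LEV_c(γ₂, B₂)}` with the LEVEL TOKEN
`LEV_c(γ₂, B₂) : (γ₂ − 1)·B₂ ⊆ c·B₂` (`∀ y ∈ B₂, c⁻¹(γ₂ − 1)y ∈ B₂`), READ ON THE LINE MODEL exactly as ★ (C1) §1 reads the token-free axis (★ (C)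
`ncard_selfDual_fixed_eq_ncard_orderLatt` ∘ ★ W4 `ncard_orderLatt_selfDual_eq_sum`): under `φ` the token is the stability of `Λ = φ(B₂) = x₀·𝒪_j` under the SECOND MULTIPLIER
`lam′ := (jE c)⁻¹(lam − 1)` (`φ(c⁻¹(γ₂ − 1)y) = (jE c)⁻¹(lam − 1)·φ y`), i.e. `lam′ ∈ 𝒪_j` (★ W3 `forall_mul_mem_iff_isOrd`).
* §1 (W4₂) THE W-SIDE ORDER CENSUS WITH TWO MULTIPLIERS: `#{Λ ∣ Λ = z·𝒪_c ∧ lamΛ ⊆ Λ ∧ lam′Λ ⊆ Λ ∧ Λ = Λ^♯} = Σ_{j ≤ J} [lam ∈ 𝒪_j ∧ lam′ ∈ 𝒪_j]·#levelSet(j, 0)`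
  (★ W4a's set identity intersected with the `lam′`-clause, read per conductor by ★ W3; ★ W4's disjoint truncated count verbatim).
* §2 the token through `φ`; §3 (C₂) the count transport with the token (★ (C)'s bijection `B ↦ φ(B)`, one more clause carried); §4 HEAD.
The cone layers (part 2b) and the block-level HEAD follow.
HONEST LABEL.  Count-neutral lattice bookkeeping; nothing printed is asserted; no census law is stated; `HC_CM` is proved only modulo the 7 printed citations (2 remaining named
inputs: hLiu418 = `stmt-HodgeConjecture-24832`, h413 = `stmt-HodgeConjecture-24833`) until rung 0 closes.

## References
* [Kottwitz1986BaseChangeUnits] R. E. Kottwitz, *Base change for unit elements of Hecke algebras*, Compositio Math. 60 (1986), §1 pp. 240–241 (orbital integrals of units as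
  fixed-lattice counts; lattices as `𝒪[γ]`-modules).
* [Flicker1998UnitaryFL] Y. Z. Flicker, *Elementary proof of the fundamental lemma for a unitary group*, Canad. J. Math. 50 (1998), p. 84 REMARK (Mars: lattices `z·R_E(j)`).
* [Jacobowitz1962] R. Jacobowitz, *Hermitian forms over local fields*, Amer. J. Math. 84 (1962), §4, §7.
* [BruhatTits1972] F. Bruhat, J. Tits, *Groupes réductifs sur un corps local I*, Publ. Math. IHÉS 41 (1972), §10.
-/

set_option autoImplicit false

noncomputable section

open scoped Valued WithZero Matrix MatrixGroups
open WithZero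
open scoped Classical
open Literature.NumberTheory.Automorphic Literature.NumberTheory.Automorphic.HermitianLattice Literature.NumberTheory.Automorphic.UnitaryLatticeTree
open Literature.NumberTheory.Rogawski1990
open Literature.NumberTheory.Automorphic.EllipticPlaneAsFieldLine
open Literature.NumberTheory.LocalFields.QuadraticOrder
open Summit.HodgeConjecture.HodgeConjecture.Cruxes.H413.F0P3cDyRamToricCensusDefs
open Summit.HodgeConjecture.HodgeConjecture.Cruxes.H413.F0P3cDyRamWSideOrderCensus

namespace Summit.HodgeConjecture.HodgeConjecture.Cruxes.H413.F0P3cDyRamBlockCensusOrderFormLevelAxis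

/-! ## §1 (W4₂) The W-side order census with two multipliers -/

section WSide

variable {K : Type*} [Field K] [Valued K ℤᵐ⁰] {ρ Θ : K →+* K} {α : K}

/-- **(W4₂a) THE SET IDENTITY WITH TWO MULTIPLIERS**: the order lattices stable under `lam` AND `lam′` that are hermitian-self-dual are the members of the level-`0` sets of
conductor `j` with `lam, lam′ ∈ 𝒪_{ϖE^j}` (★ W4a ∩ the `lam′`-clause, read by ★ W3). [cite: Kottwitz1986BaseChangeUnits, §1 pp. 240–241] [cite: Jacobowitz1962, §7] -/
theorem setOf_orderLatt_selfDual_stable₂_eq_iUnion (hρρ : ∀ x, ρ (ρ x) = x) (hvρ : ∀ x, Valued.v (ρ x) = Valued.v x) (hα : ρ α ≠ α) (hα1 : Valued.v α ≤ 1)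
    (hint : ∀ z : K, Valued.v z ≤ 1 → Valued.v ((z - ρ z) / (α - ρ α)) ≤ 1)
    (hΘΘ : ∀ x, Θ (Θ x) = x) (hΘρ : ∀ x, Θ (ρ x) = ρ (Θ x)) (hvΘ : ∀ x, Valued.v (Θ x) = Valued.v x)
    {ϖE : K} (hρϖ : ρ ϖE = ϖE) (hϖ0 : ϖE ≠ 0) (hϖ1 : Valued.v ϖE < 1)
    (hEval : ∀ c : K, ρ c = c → c ≠ 0 → Valued.v c ≤ 1 → ∃ n : ℕ, Valued.v c = Valued.v ϖE ^ n)
    {h : K} (hh : h ≠ 0) (lam lam' : K) :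
    {Λ : AddSubgroup K | (∃ z c : K, z ≠ 0 ∧ ρ c = c ∧ c ≠ 0 ∧ Valued.v c ≤ 1 ∧ ∀ x, x ∈ Λ ↔ ∃ y, IsOrd ρ α c y ∧ x = z * y) ∧
        (∀ x ∈ Λ, lam * x ∈ Λ) ∧ (∀ x ∈ Λ, lam' * x ∈ Λ) ∧ (∀ m, (∀ a ∈ Λ, Valued.v (h * Θ a * m + ρ (h * Θ a * m)) ≤ 1) ↔ m ∈ Λ)} =
      ⋃ j : ℕ, {Λ | Λ ∈ levelSet ρ Θ α ϖE h j 0 ∧ (IsOrd ρ α (ϖE ^ j) lam ∧ IsOrd ρ α (ϖE ^ j) lam')} := by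
  have hW4 := setOf_orderLatt_selfDual_eq_iUnion hρρ hvρ hα hα1 hint hΘΘ hΘρ hvΘ hρϖ hϖ0 hϖ1 hEval hh lam
  ext Λ
  have hΛ := Set.ext_iff.1 hW4 Λ
  simp only [Set.mem_setOf_eq, Set.mem_iUnion] at hΛ ⊢
  constructor
  · rintro ⟨hord, hstab, hstab', hself⟩
    obtain ⟨j, hlev, hlam⟩ := hΛ.1 ⟨hord, hstab, hself⟩
    have hlev' := hlev
    obtain ⟨x₀, hx₀, hΛj, -, -, -⟩ := hlev'
    exact ⟨j, hlev, hlam, (forall_mul_mem_iff_isOrd hvρ hx₀ hΛj lam').1 hstab'⟩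
  · rintro ⟨j, hlev, hlam, hlam'⟩
    obtain ⟨hord, hstab, hself⟩ := hΛ.2 ⟨j, hlev, hlam⟩
    have hlev' := hlev
    obtain ⟨x₀, hx₀, hΛj, -, -, -⟩ := hlev'
    exact ⟨hord, hstab, (forall_mul_mem_iff_isOrd hvρ hx₀ hΛj lam').2 hlam', hself⟩

/-- **(W4₂) THE W-SIDE ORDER CENSUS WITH TWO MULTIPLIERS.**  If the level-`0` sets are finite and `lam ∉ 𝒪_{ϖE^{J+1}}`, then
`#{Λ ∣ Λ = z·𝒪_c ∧ lam·Λ ⊆ Λ ∧ lam′·Λ ⊆ Λ ∧ Λ = Λ^♯} = Σ_{j ≤ J} (if lam ∈ 𝒪_{ϖE^j} ∧ lam′ ∈ 𝒪_{ϖE^j} then #levelSet(j, 0) else 0)` — ★ W4's disjoint truncated count with the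
second multiplier in the indicator; at `lam′ = (lam − 1)∕c` this is the axis term of the depth-`c` profile census. [cite: Kottwitz1986BaseChangeUnits, §1 pp. 240–241] [cite: Flicker1998UnitaryFL, p. 84 REMARK] [cite: Jacobowitz1962, §7] -/
theorem ncard_orderLatt_selfDual_stable₂_eq_sum (hρρ : ∀ x, ρ (ρ x) = x) (hvρ : ∀ x, Valued.v (ρ x) = Valued.v x) (hα : ρ α ≠ α) (hα1 : Valued.v α ≤ 1)
    (hint : ∀ z : K, Valued.v z ≤ 1 → Valued.v ((z - ρ z) / (α - ρ α)) ≤ 1)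
    (hΘΘ : ∀ x, Θ (Θ x) = x) (hΘρ : ∀ x, Θ (ρ x) = ρ (Θ x)) (hvΘ : ∀ x, Valued.v (Θ x) = Valued.v x)
    {ϖE : K} (hρϖ : ρ ϖE = ϖE) (hϖ0 : ϖE ≠ 0) (hϖ1 : Valued.v ϖE < 1)
    (hEval : ∀ c : K, ρ c = c → c ≠ 0 → Valued.v c ≤ 1 → ∃ n : ℕ, Valued.v c = Valued.v ϖE ^ n)
    {h : K} (hh : h ≠ 0) (lam lam' : K) {J : ℕ} (hJ : ¬ IsOrd ρ α (ϖE ^ (J + 1)) lam) (hfin : ∀ j, (levelSet ρ Θ α ϖE h j 0).Finite) :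
    {Λ : AddSubgroup K | (∃ z c : K, z ≠ 0 ∧ ρ c = c ∧ c ≠ 0 ∧ Valued.v c ≤ 1 ∧ ∀ x, x ∈ Λ ↔ ∃ y, IsOrd ρ α c y ∧ x = z * y) ∧
        (∀ x ∈ Λ, lam * x ∈ Λ) ∧ (∀ x ∈ Λ, lam' * x ∈ Λ) ∧ (∀ m, (∀ a ∈ Λ, Valued.v (h * Θ a * m + ρ (h * Θ a * m)) ≤ 1) ↔ m ∈ Λ)}.ncard =
      ∑ j ∈ Finset.range (J + 1), (if IsOrd ρ α (ϖE ^ j) lam ∧ IsOrd ρ α (ϖE ^ j) lam' then (levelSet ρ Θ α ϖE h j 0).ncard else 0) := by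
  classical
  rw [setOf_orderLatt_selfDual_stable₂_eq_iUnion hρρ hvρ hα hα1 hint hΘΘ hΘρ hvΘ hρϖ hϖ0 hϖ1 hEval hh lam lam']
  set S : ℕ → Set (AddSubgroup K) := fun j => {Λ | Λ ∈ levelSet ρ Θ α ϖE h j 0 ∧ (IsOrd ρ α (ϖE ^ j) lam ∧ IsOrd ρ α (ϖE ^ j) lam')} with hS
  have hSfin : ∀ j, (S j).Finite := fun j => (hfin j).subset fun Λ hΛ => hΛ.1
  have hSdisj : ∀ i j, i ≠ j → Disjoint (S i) (S j) := by
    intro i j hij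
    rw [Set.disjoint_left]
    intro Λ hi hj
    exact hij (eq_of_mem_levelSet_of_mem_levelSet hvρ hα hα1 hint hρϖ hϖ0 hϖ1 h hi.1 hj.1)
  have hSempty : ∀ j, J < j → S j = ∅ := by
    intro j hj
    ext Λ
    simp only [hS, Set.mem_setOf_eq, Set.mem_empty_iff_false, iff_false, not_and]
    exact fun _ h' _ => not_isOrd_pow_of_lt hϖ1.le hJ hj h'
  have hScard : ∀ j, (S j).ncard = if IsOrd ρ α (ϖE ^ j) lam ∧ IsOrd ρ α (ϖE ^ j) lam' then (levelSet ρ Θ α ϖE h j 0).ncard else 0 := by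
    intro j
    split_ifs with hlam
    · congr 1; ext Λ; simp only [hS, Set.mem_setOf_eq, and_iff_left_iff_imp]; exact fun _ => hlam
    · rw [Set.ncard_eq_zero (hSfin j)]; ext Λ
      simp only [hS, Set.mem_setOf_eq, Set.mem_empty_iff_false, iff_false, not_and]; exact fun _ h1 h2 => hlam ⟨h1, h2⟩
  have hUnion : (⋃ j : ℕ, S j) = ⋃ j ∈ Finset.range (J + 1), S j := by
    ext Λ
    simp only [Set.mem_iUnion, Finset.mem_range, exists_prop]
    constructor
    · rintro ⟨j, hj⟩
      refine ⟨j, ?_, hj⟩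
      by_contra hJj
      have : S j = ∅ := hSempty j (by omega)
      rw [this] at hj; exact hj
    · rintro ⟨j, -, hj⟩; exact ⟨j, hj⟩
  rw [show (⋃ j : ℕ, {Λ | Λ ∈ levelSet ρ Θ α ϖE h j 0 ∧ (IsOrd ρ α (ϖE ^ j) lam ∧ IsOrd ρ α (ϖE ^ j) lam')}) = ⋃ j : ℕ, S j from rfl, hUnion]
  have hgen : ∀ n : ℕ, (⋃ j ∈ Finset.range n, S j).ncard = ∑ j ∈ Finset.range n, (S j).ncard := by
    intro n
    induction n with
    | zero => simp
    | succ n ih =>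
      rw [Finset.range_add_one, Finset.sum_insert Finset.notMem_range_self, Finset.set_biUnion_insert]
      have hdisj : Disjoint (S n) (⋃ x ∈ Finset.range n, S x) := by
        rw [Set.disjoint_left]
        intro Λ hn hU
        simp only [Set.mem_iUnion, Finset.mem_range, exists_prop] at hU
        obtain ⟨j, hj, hΛj⟩ := hU
        exact (Set.disjoint_left.1 (hSdisj n j (by omega))) hn hΛj
      rw [Set.ncard_union_eq hdisj (hSfin n) ?_, ih]
      exact (Finset.range n).finite_toSet.biUnion fun j _ => hSfin j
  rw [hgen]
  exact Finset.sum_congr rfl fun j _ => hScard j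

end WSide

/-! ## §2 The level token through the line model -/

section Line

variable {E M : Type*} [Field E] [Valued E ℤᵐ⁰] [Field M] [Valued M ℤᵐ⁰] {ρ Θ : M →+* M} {α : M}

omit [Valued M ℤᵐ⁰] in
/-- **THE LEVEL TOKEN THROUGH `φ`**: for the line model `φ` (`E`-semilinear through `jE`, injective, `φ(γ₂ y) = lam·φ y`) and any `c`,
`(∀ y ∈ B, c⁻¹·(γ₂ − 1)y ∈ B) ⟺ (∀ x ∈ φB, (jE c)⁻¹(lam − 1)·x ∈ φB)` — the plane token `LEV_c(γ₂, B)` is the stability of `φ(B)` under the SECOND MULTIPLIER `(lam − 1)∕jE c`.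
[cite: Kottwitz1986BaseChangeUnits, §1 pp. 240–241] [cite: Flicker1998UnitaryFL, p. 84 REMARK] -/
theorem forall_inv_smul_sub_one_mulVec_mem_iff (jE : E →+* M) (φ : (Fin 2 → E) →+ M) (hφs : ∀ (c : E) (x : Fin 2 → E), φ (c • x) = jE c * φ x)
    (hφi : Function.Injective φ) {γ₂ : GL (Fin 2) E} {lam : M} (hφγ : ∀ x, φ ((γ₂ : Matrix (Fin 2) (Fin 2) E).mulVec x) = lam * φ x) (c : E)
    (B : Submodule 𝒪[E] (Fin 2 → E)) :
    (∀ y ∈ B, c⁻¹ • (((γ₂ : Matrix (Fin 2) (Fin 2) E) - 1) *ᵥ y) ∈ B) ↔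
      ∀ x ∈ B.toAddSubgroup.map φ, (jE c)⁻¹ * (lam - 1) * x ∈ B.toAddSubgroup.map φ := by
  have key : ∀ y : Fin 2 → E, φ (c⁻¹ • (((γ₂ : Matrix (Fin 2) (Fin 2) E) - 1) *ᵥ y)) = (jE c)⁻¹ * (lam - 1) * φ y := fun y => by
    rw [hφs, map_inv₀, Matrix.sub_mulVec, Matrix.one_mulVec, map_sub, hφγ]; ring
  constructor
  · intro hB x hx
    obtain ⟨y, hy, rfl⟩ := AddSubgroup.mem_map.1 hx
    rw [← key]
    exact AddSubgroup.mem_map.2 ⟨_, hB y hy, rfl⟩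
  · intro hΛ y hy
    have h1 := hΛ (φ y) (AddSubgroup.mem_map.2 ⟨y, hy, rfl⟩)
    rw [← key] at h1
    obtain ⟨y', hy', hyy⟩ := AddSubgroup.mem_map.1 h1
    rw [← hφi hyy]
    exact hy'

/-! ## §3 (C₂) The count transport with the token -/

/-- **(C₂) THE COUNT TRANSPORT WITH A LEVEL TOKEN.**  The `γ₂`-fixed SELF-DUAL plane lattices with `(γ₂ − 1)B ⊆ c·B` are equinumerous with the `lam`-stable,
`(lam − 1)∕jE c`-stable, hermitian-self-dual ORDER LATTICES of the line model; the bijection is ★ (C)'s `B ↦ φ(B)` with one more clause carried (§2).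
[cite: Kottwitz1986BaseChangeUnits, §1 pp. 240–241] [cite: BruhatTits1972, §10] [cite: Flicker1998UnitaryFL, p. 84 REMARK] [cite: Jacobowitz1962, §4] -/
theorem ncard_selfDual_fixed_lev_eq_ncard_orderLatt₂ (σ : E →+* E) (hvσ : ∀ a, Valued.v (σ a) = Valued.v a) {ϖ : E} (hϖ0 : ϖ ≠ 0) (hϖ1 : Valued.v ϖ ≤ 1)
    {H₂ : Matrix (Fin 2) (Fin 2) E} (hH₂ : IsUnit H₂.det) (jE : E →+* M)
    (hρρ : ∀ x, ρ (ρ x) = x) (hvρ : ∀ x, Valued.v (ρ x) = Valued.v x) (hα : ρ α ≠ α) (hα1 : Valued.v α ≤ 1)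
    (hint : ∀ z : M, Valued.v z ≤ 1 → Valued.v ((z - ρ z) / (α - ρ α)) ≤ 1)
    (hjv : ∀ c, Valued.v (jE c) ≤ 1 ↔ Valued.v c ≤ 1) (hjfix : ∀ z, ρ z = z ↔ ∃ c, jE c = z)
    (φ : (Fin 2 → E) →+ M) (hφs : ∀ (c : E) (x : Fin 2 → E), φ (c • x) = jE c * φ x) (hφi : Function.Injective φ) (hφo : Function.Surjective φ)
    {γ₂ : GL (Fin 2) E} {lam h : M} (hφγ : ∀ x, φ ((γ₂ : Matrix (Fin 2) (Fin 2) E).mulVec x) = lam * φ x) (hlam : Valued.v lam = 1)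
    (hform : ∀ x y, jE (pairing σ H₂ x y) = h * Θ (φ x) * φ y + ρ (h * Θ (φ x) * φ y)) (c : E) :
    {B : Submodule 𝒪[E] (Fin 2 → E) | IsSelfDualLattice σ ϖ H₂ B ∧ mapGL γ₂ B = B ∧ ∀ y ∈ B, c⁻¹ • (((γ₂ : Matrix (Fin 2) (Fin 2) E) - 1) *ᵥ y) ∈ B}.ncard =
      {Λ : AddSubgroup M | (∃ z c' : M, z ≠ 0 ∧ ρ c' = c' ∧ c' ≠ 0 ∧ Valued.v c' ≤ 1 ∧
          ∀ x, x ∈ Λ ↔ ∃ y, (Valued.v y ≤ 1 ∧ Valued.v (y - ρ y) ≤ Valued.v (c' * (α - ρ α))) ∧ x = z * y) ∧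
        (∀ x ∈ Λ, lam * x ∈ Λ) ∧ (∀ x ∈ Λ, (jE c)⁻¹ * (lam - 1) * x ∈ Λ) ∧ (∀ m, (∀ a ∈ Λ, Valued.v (h * Θ a * m + ρ (h * Θ a * m)) ≤ 1) ↔ m ∈ Λ)}.ncard := by
  classical
  refine Set.ncard_congr (fun B _ => B.toAddSubgroup.map φ) ?_ ?_ ?_
  · -- into
    rintro B ⟨hSD, hfix, hlev⟩
    have hdual : dualLatt σ H₂ B = B := dualLatt_eq_self_of_isSelfDualLattice hvσ hH₂ hSD
    have hlev' := (forall_inv_smul_sub_one_mulVec_mem_iff jE φ hφs hφi hφγ c B).1 hlev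
    obtain ⟨g, hBg, -, -, -⟩ := hSD
    subst hBg
    refine ⟨?_, ?_, hlev', ?_⟩
    · exact exists_eq_mul_order_map_latt jE hρρ hα hα1 hint hjv hjfix φ hφs hφi g
    · exact (mapGL_eq_iff_forall_mul_mem jE hρρ hvρ hα hα1 hint hjv hjfix φ hφs hφi hφγ hlam g).1 hfix
    · exact forall_herm_iff_mem_of_dualLatt_eq σ H₂ jE ρ Θ h hjv φ hφi hφo hform hdual
  · -- injective
    intro B B' _ _ hBB'
    exact map_toAddSubgroup_injective φ hφi hBB'
  · -- onto
    rintro Λ ⟨⟨z, c', hz0, hcfix, hc0, hc1, hΛ⟩, hstab, hstab', hself⟩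
    obtain ⟨g, hg⟩ := exists_latt_map_eq_of_order jE hρρ hα hα1 hint hjv hjfix φ hφs hφo hz0 hcfix hc0 hc1 hΛ
    refine ⟨latt (g : Matrix (Fin 2) (Fin 2) E), ⟨?_, ?_, ?_⟩, hg⟩
    · refine isSelfDualLattice_latt_of_dualLatt_eq σ hvσ hϖ0 hϖ1 hH₂ g ?_
      refine dualLatt_eq_of_forall_herm_iff_mem σ H₂ jE ρ Θ h hjv φ hφi hform ?_
      rw [hg]; exact hself
    · refine (mapGL_eq_iff_forall_mul_mem jE hρρ hvρ hα hα1 hint hjv hjfix φ hφs hφi hφγ hlam g).2 ?_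
      rw [hg]; exact hstab
    · refine (forall_inv_smul_sub_one_mulVec_mem_iff jE φ hφs hφi hφγ c _).2 ?_
      rw [hg]; exact hstab'

/-! ## §4 HEAD — the axis term with the token, in M-letters -/

/-- **AXIS TERM WITH A LEVEL TOKEN, IN M-LETTERS (HEAD of part 2a).**  `#{B₂ ∣ SD_W, γ₂B₂ = B₂, (γ₂ − 1)B₂ ⊆ c·B₂} = Σ_{j < J+1} [IsOrd (jE ϖ^j) lam ∧ IsOrd (jE ϖ^j) ((jE c)⁻¹(lam − 1))]·#levelSet(j, 0)`
— §3 ∘ §1; the token-free ★ (C1) §1 is the case where the second indicator is dropped.  For `c = ϖ^a` (`a ≥ 1`) the second indicator implies the first (`lam = 1 + (jE c)·lam′`).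
[cite: Kottwitz1986BaseChangeUnits, §1 pp. 240–241] [cite: Flicker1998UnitaryFL, p. 84 REMARK] [cite: Jacobowitz1962, §4] -/
theorem ncard_selfDual_fixed_lev_plane_eq_sum_levelSet_zero (σ : E →+* E) (hvσ : ∀ a, Valued.v (σ a) = Valued.v a) {ϖ : E} (hϖ : Valued.v ϖ = WithZero.exp (-1 : ℤ))
    {H₂ : Matrix (Fin 2) (Fin 2) E} (hH₂ : IsUnit H₂.det) (jE : E →+* M)
    (hρρ : ∀ x, ρ (ρ x) = x) (hvρ : ∀ x, Valued.v (ρ x) = Valued.v x) (hα : ρ α ≠ α) (hα1 : Valued.v α ≤ 1)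
    (hint : ∀ z : M, Valued.v z ≤ 1 → Valued.v ((z - ρ z) / (α - ρ α)) ≤ 1)
    (hΘΘ : ∀ x, Θ (Θ x) = x) (hΘρ : ∀ x, Θ (ρ x) = ρ (Θ x)) (hvΘ : ∀ x, Valued.v (Θ x) = Valued.v x)
    (hjv : ∀ c, Valued.v (jE c) ≤ 1 ↔ Valued.v c ≤ 1) (hjfix : ∀ z, ρ z = z ↔ ∃ c, jE c = z)
    (hjpow : ∀ (t : E) (n : ℤ), Valued.v (jE t) = Valued.v (jE ϖ) ^ n ↔ Valued.v t = Valued.v ϖ ^ n)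
    (hEval : ∀ c : M, ρ c = c → c ≠ 0 → Valued.v c ≤ 1 → ∃ n : ℕ, Valued.v c = Valued.v (jE ϖ) ^ n)
    (φ : (Fin 2 → E) →+ M) (hφs : ∀ (c : E) (x : Fin 2 → E), φ (c • x) = jE c * φ x) (hφi : Function.Injective φ) (hφo : Function.Surjective φ)
    {γ₂ : GL (Fin 2) E} {lam h : M} (hφγ : ∀ x, φ ((γ₂ : Matrix (Fin 2) (Fin 2) E).mulVec x) = lam * φ x) (hlam : Valued.v lam = 1)
    (hh : h ≠ 0) (hform : ∀ x y, jE (pairing σ H₂ x y) = h * Θ (φ x) * φ y + ρ (h * Θ (φ x) * φ y))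
    {J : ℕ} (hJ : ¬ IsOrd ρ α (jE ϖ ^ (J + 1)) lam) (hfin0 : ∀ j, (levelSet ρ Θ α (jE ϖ) h j 0).Finite) (c : E) :
    {B : Submodule 𝒪[E] (Fin 2 → E) | IsSelfDualLattice σ ϖ H₂ B ∧ mapGL γ₂ B = B ∧ ∀ y ∈ B, c⁻¹ • (((γ₂ : Matrix (Fin 2) (Fin 2) E) - 1) *ᵥ y) ∈ B}.ncard =
      ∑ j ∈ Finset.range (J + 1),
        (if IsOrd ρ α (jE ϖ ^ j) lam ∧ IsOrd ρ α (jE ϖ ^ j) ((jE c)⁻¹ * (lam - 1)) then (levelSet ρ Θ α (jE ϖ) h j 0).ncard else 0) := by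
  have hvϖ0 : Valued.v ϖ ≠ 0 := by rw [hϖ]; exact WithZero.exp_ne_zero
  have hϖ0 : ϖ ≠ 0 := fun h0 => by rw [h0, map_zero] at hvϖ0; exact hvϖ0 rfl
  have hϖ1 : Valued.v ϖ < 1 := by rw [hϖ, ← WithZero.exp_zero, WithZero.exp_lt_exp]; norm_num
  have hρϖ : ρ (jE ϖ) = jE ϖ := (hjfix _).2 ⟨ϖ, rfl⟩
  have hϖE0 : jE ϖ ≠ 0 := (map_ne_zero jE).2 hϖ0
  have hϖE1 : Valued.v (jE ϖ) < 1 := by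
    refine lt_of_le_of_ne ((hjv ϖ).2 hϖ1.le) fun hle => ?_
    have := (hjpow ϖ 0).1 (by rw [zpow_zero]; exact hle)
    rw [zpow_zero] at this
    exact hϖ1.ne this
  rw [ncard_selfDual_fixed_lev_eq_ncard_orderLatt₂ σ hvσ hϖ0 hϖ1.le hH₂ jE hρρ hvρ hα hα1 hint hjv hjfix φ hφs hφi hφo hφγ hlam hform c]
  exact ncard_orderLatt_selfDual_stable₂_eq_sum hρρ hvρ hα hα1 hint hΘΘ hΘρ hvΘ hρϖ hϖE0 hϖE1 hEval hh lam _ hJ hfin0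

end Line

end Summit.HodgeConjecture.HodgeConjecture.Cruxes.H413.F0P3cDyRamBlockCensusOrderFormLevelAxis

end
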